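import Summits.ResolutionOfSingularities.ResolutionOfSingularities.Theorems.EquisingularLiftEquisingularLiftNatEmbeddedLift
import Summits.ResolutionOfSingularities.ResolutionOfSingularities.Theorems.EquisingularLiftEquisingularLiftProjectiveAmbientFibre
import Summits.ResolutionOfSingularities.ResolutionOfSingularities.Theorems.EquisingularLiftEquisingularLiftProjectiveAmbientSmoothProper
import Literature.AlgebraicGeometry.Deformation.EmbeddedLiftingVanishingNormalH1
import Literature.AlgebraicGeometry.Morphisms.SmoothOfFlatFibre
import Literature.AlgebraicGeometry.FundamentalGroup.EtaleExtensionOfLiftings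
import Literature.AlgebraicGeometry.Resolution.AlterationsLemma32
import Literature.AlgebraicGeometry.Resolution.ProjectiveSpaceRegular
import HarnessLib

/-!
# [OURS · L1 W4.5(b)] EL♮ helper — T-LIFT part B: the «H¹(𝒩) = 0 NOSE» — an embedded lift of a smooth `S` is a
# REGULAR, `O`-FLAT, E1 centre; existence from Hartshorne, *Deformation Theory* Thm. 22.3

Cell res-hironaka, LADDER-RESOLUTION rung L (D-0089), slot W4.5(b), crux `Theses.EquisingularLift.EquisingularLiftNat`
(stmt-ResolutionOfSingularities-20038) and its `n = 3` child `EquisingularLiftNatThree` (stmt-ResolutionOfSingularities-20148);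
object **T-LIFT** of res-L1-w45b-lead-2's target list (CHAIN w45b v7.3 §3; lead-2 2026-08-27T08:14:45Z: «c.i./H¹(N)=0 NOSE» as an
input of the v6 cut of `stub_elnat_three_nonisolated`), `--supports stmt-ResolutionOfSingularities-20148 --as helper`.
NOT a statement of any manuscript; OURS. AI-written; AI review is weaker than expert review.

SETTING as in `…NatEmbeddedLift.lean` (part A: `LiftsEmbedded φ hφ' ι D` — `V(D) ⊆ ℙ^N_O` is `O`-flat with scheme-theoretic
special fibre `S ↪ ℙ^N_k`; `g = Proj φ : ℙ^N_k → ℙ^N_O`, `q : ℙ^N_O → Spec O`, `s₀` the closed point).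

CONTENT (all sorry-free; `O` a DVR and `π : O → k` onto the field `k` where stated).
* `LiftsEmbedded.isPullback_specialFibre` — `S = V(D) ×_{Spec O} Spec k` (pasting part A's `isPullback` with the ambient square
  `ProjectiveAmbientFibre.isPullback_projMap`).
* `smooth_of_smooth_fiber_closedPoint` — general spreading-out: a flat, locally finitely presented, universally closed `X → Spec O`
  (`O` local) with smooth fibre over the closed point is smooth.
* `LiftsEmbedded.smooth` — **if `S → Spec k` is smooth then `V(D) → Spec O` is smooth**: pointwise at the special fibre by the
  fibre criterion (Stacks 01V8 / EGA IV 17.5.1, tree `Morphisms.mem_smoothLocus_of_flat_stalkMap_of_smooth_fiber`; the fibre of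
  `V(D)` over `s₀` is `S → Spec k` up to `Spec κ(s₀) ≅ Spec k`, Mathlib `isPullback_fiberToSpecResidueField_of_isPullback`), then
  spread over the local base (tree `Morphisms.exists_smooth_morphismRestrict_of_forall_mem_smoothLocus`; `V(D)` is universally
  closed over `O`).
* `LiftsEmbedded.isRegular_subscheme` — hence **`V(D)` is a regular scheme** (EGA IV 17.5.8, tree `isRegularLocalRing_stalk_of_smooth`).
* `LiftsEmbedded.flat_id`, `LiftsEmbedded.image_support_subset_nonGeneric` (off the generic point of `Y = range (ι_H ≫ g)` as soon
  as `H ⊄ S`), `liftsEmbedded_stepData` — the four HorizChainE1 step clauses (regular ∧ flat ∧ off-generic ∧ E1) of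
  `natChain_and_isIrreducible_of_horizChainE1` (p500485) for the centre `V(D)` at level 0 (`σ' = 𝟙`), in the shape of
  `LinearCentre.linearCentre_stepData`.
* `exists_liftsEmbedded_of_normalH1` — **consumption of the named fact** `Deformation.Hartshorne2010_thm_22_3` (Hartshorne,
  *Deformation Theory* Thm. 22.3, statement-only in the tree, p514596): `k` perfect of characteristic `p`, `S ↪ ℙ^N_k` smooth with
  `H¹(S, 𝒩) = 0`, `O` a COMPLETE DVR with residue surjection `π` onto `k` ⇒ `∃ D, LiftsEmbedded φ hφ' ι D`; and
  `exists_noseStepData_of_normalH1` — the two combined: the «H¹(𝒩) = 0 NOSE» step datum, CONDITIONAL on the named fact.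

References: [Hartshorne2010, §22 Thm. 22.3 p. 169]; [StacksProject, Tag 01V8]; [Grothendieck1967, 17.5.1, 17.5.8] — via the
cited tree files; part A `…NatEmbeddedLift.lean`; `…NatLinearCentre.lean` (pattern) — OURS, index only.
-/

set_option linter.dupNamespace false -- mandated namespace `Summit.<Summit>.<Problem>` of this single-conjunct summit

noncomputable section

open CategoryTheory CategoryTheory.Limits AlgebraicGeometry TopologicalSpace
open MvPolynomial
open AlgebraicGeometry.Scheme.IdealSheafData

attribute [local instance] MvPolynomial.gradedAlgebra

namespace Summit.ResolutionOfSingularities.ResolutionOfSingularities.Cruxes.EquisingularLiftNat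

namespace EmbeddedLift

open Literature.AlgebraicGeometry.Resolution

/-- Over a locally Noetherian base, locally of finite type ⇒ locally of finite presentation (a copy of
`HodgeTheory.locallyOfFinitePresentation_of_isLocallyNoetherian`, kept private to keep the imports small). [folklore] -/
private theorem locallyOfFinitePresentation_of_isLocallyNoetherian {X Y : Scheme.{0}} (g : X ⟶ Y)
    [IsLocallyNoetherian Y] [LocallyOfFiniteType g] : LocallyOfFinitePresentation g := by
  rw [HasRingHomProperty.iff_appLE (P := @LocallyOfFinitePresentation)]
  intro U V e
  haveI := IsLocallyNoetherian.component_noetherian (X := Y) U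
  exact RingHom.FinitePresentation.of_finiteType.mp
    (HasRingHomProperty.appLE @LocallyOfFiniteType g inferInstance U V e)

/-- **Smooth special fibre ⇒ smooth, over a local base, for universally closed flat maps** (the spreading-out behind
`LiftsEmbedded.smooth`, stated generally for reuse by the chain's other `O`-models): `O` local, `f : X → Spec O` flat, locally of
finite presentation and universally closed (e.g. `X` a closed subscheme of `ℙ^N_O` flat over `O`); if the fibre of `f` over the
closed point is smooth over `κ(𝔪_O)` then `f` is smooth. Pointwise Stacks 01V8 at the special points (tree
`Morphisms.mem_smoothLocus_of_flat_stalkMap_of_smooth_fiber`), then `f` is smooth over an open neighbourhood of the closed point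
(tree `Morphisms.exists_smooth_morphismRestrict_of_forall_mem_smoothLocus`), which is all of `Spec O`. [folklore] -/
theorem smooth_of_smooth_fiber_closedPoint {O : Type} [CommRing O] [IsLocalRing O] {X : Scheme.{0}}
    (f : X ⟶ Spec (.of O)) [Flat f] [LocallyOfFinitePresentation f] [UniversallyClosed f]
    (h : Smooth (f.fiberToSpecResidueField (IsLocalRing.closedPoint O))) : Smooth f := by
  have key : ∀ x : X, f x = IsLocalRing.closedPoint O → x ∈ f.smoothLocus := by
    intro x hx
    refine Literature.AlgebraicGeometry.Morphisms.mem_smoothLocus_of_flat_stalkMap_of_smooth_fiber f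
      (Flat.stalkMap f x) ?_
    rw [hx]
    exact h
  obtain ⟨V, hV, hsmV⟩ :=
    Literature.AlgebraicGeometry.Morphisms.exists_smooth_morphismRestrict_of_forall_mem_smoothLocus f key
  have hVtop : V = ⊤ := (IsLocalRing.closedPoint_mem_iff V).mp hV
  subst hVtop
  exact IsZariskiLocalAtTarget.of_iSup_eq_top (P := @Smooth) (fun _ : Unit => (⊤ : (Spec (CommRingCat.of O)).Opens))
    (by rw [iSup_const]) fun _ => hsmV

section SpecialFibreSquare

variable {O k : Type} [CommRing O] [CommRing k] (π : O →+* k) (hπ : Function.Surjective π) {N : ℕ}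
  {φ : (homogeneousSubmodule (Fin (N + 1)) O) →+*ᵍ (homogeneousSubmodule (Fin (N + 1)) k)}
  (hφ : ∀ q, φ q = MvPolynomial.map π q)
  {hφ' : HomogeneousIdeal.irrelevant (homogeneousSubmodule (Fin (N + 1)) k) ≤
    (HomogeneousIdeal.irrelevant (homogeneousSubmodule (Fin (N + 1)) O)).map φ}
  {S : Scheme.{0}} {ι : S ⟶ Proj (homogeneousSubmodule (Fin (N + 1)) k)}
  {D : (Proj (homogeneousSubmodule (Fin (N + 1)) O)).IdealSheafData}

include hπ hφ in
/-- **`S = V(D) ×_{Spec O} Spec k`**: pasting `LiftsEmbedded.isPullback` (`S = V(D) ×_P ℙ^N_k`) with the ambient square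
`ℙ^N_k = ℙ^N_O ×_O k` (`ProjectiveAmbientFibre.isPullback_projMap`): the square with top `S → ℙ^N_k → Spec k`, left `S → V(D)`,
right `Spec k → Spec O` (`Spec π`), bottom `V(D) ↪ ℙ^N_O → Spec O` is cartesian. [folklore] -/
theorem LiftsEmbedded.isPullback_specialFibre [IsClosedImmersion ι] (h : LiftsEmbedded φ hφ' ι D) :
    IsPullback (ι ≫ (Proj.toSpecZero (homogeneousSubmodule (Fin (N + 1)) k) ≫
        Spec.map (CommRingCat.ofHom (algebraMap k ((homogeneousSubmodule (Fin (N + 1)) k) 0)))))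
      h.lift (Spec.map (CommRingCat.ofHom π))
      (D.subschemeι ≫ (Proj.toSpecZero (homogeneousSubmodule (Fin (N + 1)) O) ≫
        Spec.map (CommRingCat.ofHom (algebraMap O ((homogeneousSubmodule (Fin (N + 1)) O) 0))))) :=
  h.isPullback.paste_horiz
    (Cruxes.EquisingularLift.StrataSplit.ProjectiveAmbientFibre.isPullback_projMap π φ hφ hπ hφ').flip

end SpecialFibreSquare

section Smooth

variable {O k : Type} [CommRing O] [IsDomain O] [IsDiscreteValuationRing O] [Field k] (π : O →+* k)
  (hπ : Function.Surjective π) {N : ℕ}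
  {φ : (homogeneousSubmodule (Fin (N + 1)) O) →+*ᵍ (homogeneousSubmodule (Fin (N + 1)) k)}
  (hφ : ∀ q, φ q = MvPolynomial.map π q)
  {hφ' : HomogeneousIdeal.irrelevant (homogeneousSubmodule (Fin (N + 1)) k) ≤
    (HomogeneousIdeal.irrelevant (homogeneousSubmodule (Fin (N + 1)) O)).map φ}
  {S : Scheme.{0}} {ι : S ⟶ Proj (homogeneousSubmodule (Fin (N + 1)) k)}
  {D : (Proj (homogeneousSubmodule (Fin (N + 1)) O)).IdealSheafData}

include hπ hφ in
/-- **An embedded lift of a smooth `S` is smooth over `O`** (`O` a DVR, `π : O → k` onto the field `k`, `S → Spec k` smooth).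
Pointwise at the special fibre: `V(D)` is `O`-flat, and its fibre over the closed point `s₀` is, up to the isomorphism
`Spec κ(s₀) ≅ Spec k` (residue field of the closed immersion `Spec k → Spec O`), the smooth `S → Spec k`
(`LiftsEmbedded.isPullback_specialFibre` + Mathlib `isPullback_fiberToSpecResidueField_of_isPullback`), so every special-fibre
point is a smooth point by the fibre criterion Stacks 01V8 (tree `Morphisms.mem_smoothLocus_of_flat_stalkMap_of_smooth_fiber`).
Globally: `V(D) → Spec O` is universally closed (closed in the proper `ℙ^N_O`), hence smooth over an open neighbourhood of `s₀`
(tree `Morphisms.exists_smooth_morphismRestrict_of_forall_mem_smoothLocus`), which is all of `Spec O` (`O` local). [folklore] -/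
theorem LiftsEmbedded.smooth [IsClosedImmersion ι] (h : LiftsEmbedded φ hφ' ι D)
    (hS : Smooth (ι ≫ (Proj.toSpecZero (homogeneousSubmodule (Fin (N + 1)) k) ≫
        Spec.map (CommRingCat.ofHom (algebraMap k ((homogeneousSubmodule (Fin (N + 1)) k) 0)))))) :
    Smooth (D.subschemeι ≫ (Proj.toSpecZero (homogeneousSubmodule (Fin (N + 1)) O) ≫
        Spec.map (CommRingCat.ofHom (algebraMap O ((homogeneousSubmodule (Fin (N + 1)) O) 0))))) := by
  set r := D.subschemeι ≫ (Proj.toSpecZero (homogeneousSubmodule (Fin (N + 1)) O) ≫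
    Spec.map (CommRingCat.ofHom (algebraMap O ((homogeneousSubmodule (Fin (N + 1)) O) 0)))) with hr
  set qk := Proj.toSpecZero (homogeneousSubmodule (Fin (N + 1)) k) ≫
    Spec.map (CommRingCat.ofHom (algebraMap k ((homogeneousSubmodule (Fin (N + 1)) k) 0))) with hqk
  obtain ⟨hsmP, hprP⟩ := Cruxes.EquisingularLift.StrataSplit.stub_projectiveAmbientSmoothProper O N
  haveI := hsmP
  haveI := hprP
  haveI := hS
  haveI : Flat r := h.flat
  haveI : LocallyOfFinitePresentation r := locallyOfFinitePresentation_of_isLocallyNoetherian r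
  haveI : UniversallyClosed r := inferInstance
  -- the special-fibre square and its fibre over the point `y` of `Spec k`
  have hsq := h.isPullback_specialFibre π hπ hφ
  let y : ↥(Spec (CommRingCat.of k)) := default
  have hy : Spec.map (CommRingCat.ofHom π) y = IsLocalRing.closedPoint O :=
    LinearCentre.specMap_apply_eq_closedPoint π hπ y
  have hfsq := isPullback_fiberToSpecResidueField_of_isPullback hsq.flip y
  -- the comparison `Spec κ(y) → Spec κ(s₀)` is an isomorphism (`π` is onto)
  haveI : IsClosedImmersion (Spec.map (CommRingCat.ofHom π)) := IsClosedImmersion.spec_of_surjective _ hπ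
  have hbij : Function.Bijective ((Spec.map (CommRingCat.ofHom π)).residueFieldMap y).hom :=
    ⟨((Spec.map (CommRingCat.ofHom π)).residueFieldMap y).hom.injective,
      Literature.AlgebraicGeometry.FundamentalGroup.residueFieldMap_surjective_of_surjectiveOnStalks _ y⟩
  haveI : IsIso ((Spec.map (CommRingCat.ofHom π)).residueFieldMap y) :=
    (ConcreteCategory.isIso_iff_bijective _).mpr hbij
  haveI hM := hfsq.isIso_fst_of_isIso
  have hV₁ : Smooth ((ι ≫ qk).fiberToSpecResidueField y) :=
    MorphismProperty.pullback_snd (P := @Smooth) _ _ hS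
  -- hence the special fibre of `r` is smooth, and `r` is smooth by spreading out over the local base
  have hV₂ : Smooth (r.fiberToSpecResidueField (Spec.map (CommRingCat.ofHom π) y)) := by
    have hw := hfsq.w
    rw [← IsIso.eq_inv_comp] at hw
    rw [hw]
    exact MorphismProperty.comp_mem _ _ _ inferInstance (MorphismProperty.comp_mem _ _ _ hV₁ inferInstance)
  rw [hy] at hV₂
  exact smooth_of_smooth_fiber_closedPoint r hV₂

include hπ hφ in
/-- **An embedded lift of a smooth `S` is a regular scheme** (`O` a DVR): `V(D) → Spec O` is smooth (`LiftsEmbedded.smooth`)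
and `Spec O` is regular, so every local ring of `V(D)` is regular (EGA IV 17.5.8, tree `isRegularLocalRing_stalk_of_smooth`).
This is the regularity clause of a HorizChainE1 step with centre `V(D)`. [folklore] -/
theorem LiftsEmbedded.isRegular_subscheme [IsClosedImmersion ι] (h : LiftsEmbedded φ hφ' ι D)
    (hS : Smooth (ι ≫ (Proj.toSpecZero (homogeneousSubmodule (Fin (N + 1)) k) ≫
        Spec.map (CommRingCat.ofHom (algebraMap k ((homogeneousSubmodule (Fin (N + 1)) k) 0)))))) :
    Scheme.IsRegular D.subscheme := by
  haveI := h.smooth π hπ hφ hS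
  exact fun x => isRegularLocalRing_stalk_of_smooth
    (D.subschemeι ≫ (Proj.toSpecZero (homogeneousSubmodule (Fin (N + 1)) O) ≫
      Spec.map (CommRingCat.ofHom (algebraMap O ((homogeneousSubmodule (Fin (N + 1)) O) 0))))) x
    (Scheme.isRegular_Spec (.of O) _)

end Smooth

section StepData

variable {O k : Type} [CommRing O] [IsDomain O] [IsDiscreteValuationRing O] [Field k] (π : O →+* k)
  (hπ : Function.Surjective π) {N : ℕ}
  {φ : (homogeneousSubmodule (Fin (N + 1)) O) →+*ᵍ (homogeneousSubmodule (Fin (N + 1)) k)}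
  (hφ : ∀ q, φ q = MvPolynomial.map π q)
  {hφ' : HomogeneousIdeal.irrelevant (homogeneousSubmodule (Fin (N + 1)) k) ≤
    (HomogeneousIdeal.irrelevant (homogeneousSubmodule (Fin (N + 1)) O)).map φ}
  {S : Scheme.{0}} {ι : S ⟶ Proj (homogeneousSubmodule (Fin (N + 1)) k)}
  {D : (Proj (homogeneousSubmodule (Fin (N + 1)) O)).IdealSheafData}

omit [IsDomain O] [IsDiscreteValuationRing O] in
/-- The flatness clause in the shape of a level-0 HorizChainE1 step (`σ' = 𝟙`). [folklore] -/
theorem LiftsEmbedded.flat_id (h : LiftsEmbedded φ hφ' ι D) :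
    Flat (D.subschemeι ≫ 𝟙 _ ≫ (Proj.toSpecZero (homogeneousSubmodule (Fin (N + 1)) O) ≫
      Spec.map (CommRingCat.ofHom (algebraMap O ((homogeneousSubmodule (Fin (N + 1)) O) 0))))) := by
  rw [Category.id_comp]
  exact h.flat

omit [IsDomain O] [IsDiscreteValuationRing O] in
include hπ hφ in
/-- **An embedded lift of `S ⊊ H` is off the generic point of `Y = range (ι_H ≫ g)`** (the HorizChainE1 «off-generic» clause at
level 0, `σ' = 𝟙`): for an integral `H` with a closed immersion `ι_H : H → ℙ^N_k` NOT contained in `S` (`range ι_H ⊄ range ι`),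
no point of `supp D` is the generic point of `Y` — that generic point is `g (ι_H η_H)`, and `g⁻¹ supp D = range ι` is closed, so
it would contain all of `ι_H(H)` (cf. `LinearCentre.image_support_subset_nonGeneric`). [folklore] -/
theorem LiftsEmbedded.image_support_subset_nonGeneric [IsClosedImmersion ι] (h : LiftsEmbedded φ hφ' ι D)
    {H : Scheme.{0}} [IsIntegral H] (ιH : H ⟶ Proj (homogeneousSubmodule (Fin (N + 1)) k)) [IsClosedImmersion ιH]
    (hH : ¬ Set.range ιH ⊆ Set.range ι) :
    (𝟙 (Proj (homogeneousSubmodule (Fin (N + 1)) O)) : _ ⟶ _) ''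
        (D.support : Set (Proj (homogeneousSubmodule (Fin (N + 1)) O))) ⊆
      {x | ¬ IsGenericPoint x (Set.range (ιH ≫ Proj.map φ hφ'))} := by
  set g := Proj.map φ hφ' with hg
  haveI : IsClosedImmersion g :=
    Literature.AlgebraicGeometry.FundamentalGroup.isClosedImmersion_projMap_of_surjective φ hφ' fun q => by
      obtain ⟨s, hs⟩ := MvPolynomial.map_surjective π hπ q
      exact ⟨s, (hφ s).trans hs⟩
  let f : H ⟶ Proj (homogeneousSubmodule (Fin (N + 1)) O) := ιH ≫ g
  have hgenj : IsGenericPoint (ιH (genericPoint H)) (Set.range ιH) := by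
    have h1 := (genericPoint_spec H).image ιH.continuous
    rwa [Set.image_univ, ιH.isClosedEmbedding.isClosed_range.closure_eq] at h1
  rintro _ ⟨x, hx, rfl⟩ hgx
  change IsGenericPoint x (Set.range f) at hgx
  apply hH
  -- `x = f η_H`: both are generic points of the irreducible closed set `range f ∋ x`? — `x ∈ range f = f '' univ`, and
  -- `closure {x} = range f ⊇ {f η_H}`; conversely `f η_H` specialises to every point of `range f`.
  have hxmem : x ∈ Set.range f := hgx.mem
  obtain ⟨a, rfl⟩ := hxmem
  -- `ιH a ∈ g⁻¹ supp D = range ι`, a closed set; its closure in `ℙ^N_k` contains `ιH '' closure {a} = ιH(H)` since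
  -- `closure {f a} = range f` forces `closure {a} = H` (f a closed embedding).
  have ha : IsGenericPoint a (Set.univ : Set H) := by
    rw [isGenericPoint_iff_specializes] at hgx ⊢
    intro b
    simp only [Set.mem_univ, iff_true]
    exact (f.isClosedEmbedding.isEmbedding.specializes_iff).mp ((hgx (f b)).mpr ⟨b, rfl⟩)
  have hmem : ιH a ∈ (Set.range ι : Set _) := by
    rw [← h.preimage_support]
    change g (ιH a) ∈ (D.support : Set _)
    rw [← Scheme.Hom.comp_apply]
    exact hx
  have hgen' : IsGenericPoint (ιH a) (Set.range ιH) := by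
    have h1 := ha.image ιH.continuous
    rwa [Set.image_univ, ιH.isClosedEmbedding.isClosed_range.closure_eq] at h1
  rw [← hgen']
  exact closure_minimal (Set.singleton_subset_iff.mpr hmem) ι.isClosedEmbedding.isClosed_range

include hπ hφ in
/-- **AN EMBEDDED LIFT AS A LEVEL-0 HorizChainE1 STEP DATUM** — the «NOSE» step of `stub_elnat_three_nonisolated` LEVEL 0
(CRUX-PLAN §1.3, LEAD-MEMO-1 §3: the first centre touching `η_Σ` is a lift of `Σ`): in the literal step-clause order of
`natChain_and_isIrreducible_of_horizChainE1` (p500485) with `σ' = 𝟙 P`, `Y' = Y = range (ι_H ≫ g)` — `V(D)` regular ∧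
`V(D) → Spec O` flat ∧ `supp D` off the generic point of `Y` ∧ (E1) the special-fibre points of `supp D` lie in `Y` — for `D` an
embedded `O`-lift of a SMOOTH `S ↪ ℙ^N_k` with `S ⊆ H` (`range ι ⊆ range ι_H`) and `H ⊄ S`, `H` integral, `O` a DVR, `π` onto `k`
(cf. `LinearCentre.linearCentre_stepData`). With `exists_liftsEmbedded_of_normalH1` (Hartshorne DT 22.3): a smooth `Σ ⊆ Sing H`
with `H¹(Σ, 𝒩_{Σ/ℙ³}) = 0` admits a NOSE step over `W(k)`. [folklore] -/
theorem liftsEmbedded_stepData [IsClosedImmersion ι] (h : LiftsEmbedded φ hφ' ι D)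
    (hS : Smooth (ι ≫ (Proj.toSpecZero (homogeneousSubmodule (Fin (N + 1)) k) ≫
        Spec.map (CommRingCat.ofHom (algebraMap k ((homogeneousSubmodule (Fin (N + 1)) k) 0))))))
    {H : Scheme.{0}} [IsIntegral H] (ιH : H ⟶ Proj (homogeneousSubmodule (Fin (N + 1)) k)) [IsClosedImmersion ιH]
    {Y : Set (Proj (homogeneousSubmodule (Fin (N + 1)) O))} (hY : Y = Set.range (ιH ≫ Proj.map φ hφ'))
    (hSH : Set.range ι ⊆ Set.range ιH) (hH : ¬ Set.range ιH ⊆ Set.range ι) :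
    Scheme.IsRegular D.subscheme ∧
    Flat (D.subschemeι ≫ 𝟙 _ ≫ (Proj.toSpecZero (homogeneousSubmodule (Fin (N + 1)) O) ≫
      Spec.map (CommRingCat.ofHom (algebraMap O ((homogeneousSubmodule (Fin (N + 1)) O) 0))))) ∧
    (𝟙 (Proj (homogeneousSubmodule (Fin (N + 1)) O)) : _ ⟶ _) ''
        (D.support : Set (Proj (homogeneousSubmodule (Fin (N + 1)) O))) ⊆ {x | ¬ IsGenericPoint x Y} ∧
    (D.support : Set (Proj (homogeneousSubmodule (Fin (N + 1)) O))) ∩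
        (𝟙 (Proj (homogeneousSubmodule (Fin (N + 1)) O)) ≫
          (Proj.toSpecZero (homogeneousSubmodule (Fin (N + 1)) O) ≫
            Spec.map (CommRingCat.ofHom (algebraMap O ((homogeneousSubmodule (Fin (N + 1)) O) 0))))) ⁻¹'
          {IsLocalRing.closedPoint O} ⊆ Y := by
  subst hY
  exact ⟨h.isRegular_subscheme π hπ hφ hS, h.flat_id, h.image_support_subset_nonGeneric π hπ hφ ιH hH,
    h.support_inter_specialFibre_subset_range π hπ hφ ιH hSH⟩

end StepData

end EmbeddedLift

end Summit.ResolutionOfSingularities.ResolutionOfSingularities.Cruxes.EquisingularLiftNat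

namespace Summit.ResolutionOfSingularities.ResolutionOfSingularities.Cruxes.EquisingularLiftNat

namespace EmbeddedLift

open Literature.AlgebraicGeometry.Resolution

section Existence

variable {O k : Type} [CommRing O] [IsDomain O] [IsDiscreteValuationRing O]
  [IsAdicComplete (IsLocalRing.maximalIdeal O) O] [Field k] {p : ℕ} [CharP k p] [PerfectField k]
  (π : O →+* k) (hπ : Function.Surjective π) {N : ℕ}
  (φ : (homogeneousSubmodule (Fin (N + 1)) O) →+*ᵍ (homogeneousSubmodule (Fin (N + 1)) k))
  (hφ : ∀ q, φ q = MvPolynomial.map π q)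
  (hφ' : HomogeneousIdeal.irrelevant (homogeneousSubmodule (Fin (N + 1)) k) ≤
    (HomogeneousIdeal.irrelevant (homogeneousSubmodule (Fin (N + 1)) O)).map φ)
  {S : Scheme.{0}} (ι : S ⟶ Proj (homogeneousSubmodule (Fin (N + 1)) k)) [IsClosedImmersion ι]

include hπ hφ in
/-- **`H¹(S, 𝒩) = 0` ⇒ an embedded `O`-lift of `S` exists** — CONDITIONAL on the named fact [Hartshorne2010, Thm. 22.3]
(`Deformation.Hartshorne2010_thm_22_3`, statement-only in the tree): `k` perfect of characteristic `p`, `S ↪ ℙ^N_k` a smooth closed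
subscheme with `H¹(S, 𝒩_{S/ℙ^N_k}) = 0` (`HodgeTheory.normalSheafCohomology ι 1` a subsingleton), `O` a complete discrete valuation
ring and `π : O → k` a surjection (so `k` is the residue field of `O`). One-line consumption of the fact in the EL♮ spelling. [folklore] -/
theorem exists_liftsEmbedded_of_normalH1 (h22 : Literature.AlgebraicGeometry.Deformation.Hartshorne2010_thm_22_3.{0})
    (hp : p.Prime)
    (hS : Smooth (ι ≫ (Proj.toSpecZero (homogeneousSubmodule (Fin (N + 1)) k) ≫
        Spec.map (CommRingCat.ofHom (algebraMap k ((homogeneousSubmodule (Fin (N + 1)) k) 0))))))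
    (hH1 : Subsingleton (Literature.AlgebraicGeometry.HodgeTheory.normalSheafCohomology ι 1)) :
    ∃ D : (Proj (homogeneousSubmodule (Fin (N + 1)) O)).IdealSheafData, LiftsEmbedded φ hφ' ι D :=
  h22 p hp k N S ι inferInstance hS hH1 O π hπ φ hφ' hφ

include hπ hφ in
/-- **THE «H¹(𝒩) = 0 NOSE» STEP DATUM** (lead-2 2026-08-27T08:14:45Z, input of the v6 cut of `stub_elnat_three_nonisolated`),
CONDITIONAL on [Hartshorne2010, Thm. 22.3]: for `H ↪ ℙ^N_k` integral, `S ↪ ℙ^N_k` a SMOOTH closed subscheme with `S ⊆ H`, `H ⊄ S`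
(e.g. `S = (Sing H)_red` a smooth curve of a singular surface) and `H¹(S, 𝒩_{S/ℙ^N}) = 0`, over a complete DVR `O` with residue
field `k` (perfect, char `p`) there is an ideal sheaf `D` on `ℙ^N_O` — an embedded lift of `S` — satisfying the four level-0
HorizChainE1 step clauses for `(ℙ^N_O, 𝟙, Y = range (ι_H ≫ g))`: `V(D)` regular ∧ `O`-flat ∧ off the generic point of `Y` ∧ (E1)
special support inside `Y`. [folklore] -/
theorem exists_noseStepData_of_normalH1 (h22 : Literature.AlgebraicGeometry.Deformation.Hartshorne2010_thm_22_3.{0})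
    (hp : p.Prime)
    (hS : Smooth (ι ≫ (Proj.toSpecZero (homogeneousSubmodule (Fin (N + 1)) k) ≫
        Spec.map (CommRingCat.ofHom (algebraMap k ((homogeneousSubmodule (Fin (N + 1)) k) 0))))))
    (hH1 : Subsingleton (Literature.AlgebraicGeometry.HodgeTheory.normalSheafCohomology ι 1))
    {H : Scheme.{0}} [IsIntegral H] (ιH : H ⟶ Proj (homogeneousSubmodule (Fin (N + 1)) k)) [IsClosedImmersion ιH]
    {Y : Set (Proj (homogeneousSubmodule (Fin (N + 1)) O))} (hY : Y = Set.range (ιH ≫ Proj.map φ hφ'))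
    (hSH : Set.range ι ⊆ Set.range ιH) (hH : ¬ Set.range ιH ⊆ Set.range ι) :
    ∃ D : (Proj (homogeneousSubmodule (Fin (N + 1)) O)).IdealSheafData,
      LiftsEmbedded φ hφ' ι D ∧
      Scheme.IsRegular D.subscheme ∧
      Flat (D.subschemeι ≫ 𝟙 _ ≫ (Proj.toSpecZero (homogeneousSubmodule (Fin (N + 1)) O) ≫
        Spec.map (CommRingCat.ofHom (algebraMap O ((homogeneousSubmodule (Fin (N + 1)) O) 0))))) ∧
      (𝟙 (Proj (homogeneousSubmodule (Fin (N + 1)) O)) : _ ⟶ _) ''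
          (D.support : Set (Proj (homogeneousSubmodule (Fin (N + 1)) O))) ⊆ {x | ¬ IsGenericPoint x Y} ∧
      (D.support : Set (Proj (homogeneousSubmodule (Fin (N + 1)) O))) ∩
          (𝟙 (Proj (homogeneousSubmodule (Fin (N + 1)) O)) ≫
            (Proj.toSpecZero (homogeneousSubmodule (Fin (N + 1)) O) ≫
              Spec.map (CommRingCat.ofHom (algebraMap O ((homogeneousSubmodule (Fin (N + 1)) O) 0))))) ⁻¹'
            {IsLocalRing.closedPoint O} ⊆ Y := by
  obtain ⟨D, hD⟩ := exists_liftsEmbedded_of_normalH1 π hπ φ hφ hφ' ι h22 hp hS hH1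
  exact ⟨D, hD, liftsEmbedded_stepData π hπ hφ hD hS ιH hY hSH hH⟩

end Existence

end EmbeddedLift

end Summit.ResolutionOfSingularities.ResolutionOfSingularities.Cruxes.EquisingularLiftNat

end
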